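import Summits.Ventures.CertifiedQuantumChemistry.Rows.CIUpperBound
import Summits.Ventures.CertifiedQuantumChemistry.Rows.CholeskyResidualBound
import HarnessLib

/-!
# Ventures/CertifiedQuantumChemistry — Rows/SectorBlockLowerBound.lean: the SECTOR-BLOCK BRIDGE
# (a lower bound on the determinant-basis block of `H_F` on one `(N_α, N_β)` sector is a LOWER ROW)

HONEST FRAMING (verbatim): certified bounds for a stated model Hamiltonian in a stated basis; not a
claim about the real molecule beyond that model.

Typer file (seat `pub-qchem-typer`, TYP-17 (b)(ii)/(iii) option (β); theorems only, no `def`, no claim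
node, no model, NO BOUND ASSERTED; zero compute). It is the `Rows/`-class companion of var-2's
`Rows/CholeskyResidualBound.lean` that the referee's R.75 NOTE names ("a CHOL Lower node per row needs
the sector-block bridge"): `CholeskyResidualBound` stops at the MATRIX (`λ_min(A) ≥ μ − τ/c − ε` for
the integer data of a `qc-lower-chol-v0` certificate, as a real quadratic-form bound
`lo · (w ⬝ᵥ w) ≤ w ⬝ᵥ (A *ᵥ w)`); this file carries such a bound from the `(a, b)` SECTOR BLOCK of the
model Hamiltonian in the occupation (determinant) basis to the row predicate `LowerRow F a b lo` of
`Statement.lean`, i.e. to `lo ≤ E₀(H_F; N_α = a, N_β = b)`: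

* `lowerRow_of_forall_isInSector` — the variational form of the lower row: if
  `lo · ⟨ψ,ψ⟩ ≤ Re ⟨ψ, H_F ψ⟩` for EVERY vector `ψ` of the `(a, b)` sector (`IsInSector a b ψ`), then
  `LowerRow F a b lo` (the sector energy is attained by a unit eigenvector of the sector,
  `exists_unit_eigen_sectorGroundEnergy`);
* `lowerRow_of_sectorBlock_form` — **THE BRIDGE in the referee's words** ("an orthonormal family
  spanning the `(na, nb)` sector of the pinned model + the matrix of `H` on it bounded below by `E·I`
  ⇒ `E ≤ sectorGroundEnergy H na nb`"): for ANY enumeration `d : ι → occupation sets` of the sector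
  (injective and covering the sector — the orthonormal family is the occupation basis `|d i⟩` in any
  order, e.g. FORMAT-qcchol0's α-string × β-string `combinations` order) and the REAL matrix `A i j = ⟨d i| H_F |d j⟩ = F.slaterCondon (d i) (d j)` (the kernel's
  ℚ-valued Slater–Condon element, `Rows/CIUpperBound.lean`, `= F.hamiltonian (d i) (d j)` by
  `hamiltonian_apply_eq_slaterCondon`), a quadratic-form bound `lo · (w ⬝ᵥ w) ≤ w ⬝ᵥ (A *ᵥ w)` for all
  real `w` gives `LowerRow F a b lo`;
* `lowerRow_of_sectorBlock_sub_posSemidef` — the same with the hypothesis packaged as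
  `(A − lo·1).PosSemidef` over `ℝ` ("bounded below by `E·I`");
* `lowerRow_of_sectorBlock_blocks` — the same from a labelling `lab : ι → G` under which `A` is block
  diagonal and a per-block form bound (the D2h blocks of a `qc-lower-chol-v0` certificate:
  `le_dotProduct_mulVec_of_blockDiagonal` of `CholeskyResidualBound.lean` does the assembly).

The complex-to-real step is the elementary identity `Re ⟨w, A w⟩ = x ⬝ᵥ (A x) + y ⬝ᵥ (A y)` for a REAL
matrix `A` and `w = x + i y` (`re_star_dotProduct_map_mulVec`; no symmetry of `A` needed for the real
part) with `Re ⟨w, w⟩ = x ⬝ᵥ x + y ⬝ᵥ y`; the sector step is the re-indexing of a sum supported on the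
sector by the enumeration `d` (`sum_eq_sum_enum_of_support`). With this file a `qc-lower-chol-v0`
certificate's kernel chain reads: integer identity + row sums (instance data, the readers) ⇒
`CholeskyResidualBound.le_dotProduct_mulVec_of_integer_residual` / `…_rounded` / `…_of_blockDiagonal`
(form bound on the rounded, then the exact block) ⇒ `lowerRow_of_sectorBlock_form` (this file) ⇒
`LowerRow`, exactly parallel to 'relaxation feasible for all sector states ⇒ E_L ≤ sectorGroundEnergy'
on the SDP side (`Literature/…/VariationalRDMRelaxation`, `ThreeIndexRelaxationBound`). Nothing here is
specific to Cholesky: any certified lower bound on the dense sector block (LDLᵀ, interval Lanczos with a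
residual bound, an SOS in the determinant basis) enters through the same door. Reference for the
variational principle on a finite-dimensional invariant subspace: Horn–Johnson, *Matrix Analysis*
(2013) Thm 4.2.2 (Rayleigh quotient) — here in the tree's own form `exists_unit_eigen_sectorGroundEnergy`
(Tasaki 2020 §2.2).
-/

noncomputable section

namespace Summit.Ventures.CertifiedQuantumChemistry

open Matrix Finset
open Literature.MathematicalPhysics.QuantumLattice Literature.MathematicalPhysics.QuantumChemistry
open scoped ComplexOrder

/-! ### Real matrices acting on complex vectors -/

/-- For a REAL matrix `A` and a complex vector `w = x + i y`:
`Re ⟨w, A w⟩ = x ⬝ᵥ (A x) + y ⬝ᵥ (A y)` (no symmetry of `A` needed for the real part). -/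
theorem re_star_dotProduct_map_mulVec {ι : Type*} [Fintype ι] (A : Matrix ι ι ℝ) (w : ι → ℂ) :
    (star w ⬝ᵥ ((A.map ((↑) : ℝ → ℂ)) *ᵥ w)).re =
      (fun i => (w i).re) ⬝ᵥ (A *ᵥ fun i => (w i).re) +
        (fun i => (w i).im) ⬝ᵥ (A *ᵥ fun i => (w i).im) := by
  simp only [dotProduct, mulVec, Matrix.map_apply, Pi.star_apply, Complex.re_sum, Finset.mul_sum,
    Complex.mul_re, Complex.star_def, Complex.conj_re, Complex.conj_im, Complex.ofReal_re,
    Complex.ofReal_im, Complex.mul_im, ← Finset.sum_add_distrib]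
  refine Finset.sum_congr rfl fun i _ => Finset.sum_congr rfl fun j _ => ?_
  ring

/-- `Re ⟨w, w⟩ = x ⬝ᵥ x + y ⬝ᵥ y` for `w = x + i y`. -/
theorem re_star_dotProduct_self {ι : Type*} [Fintype ι] (w : ι → ℂ) :
    (star w ⬝ᵥ w).re =
      (fun i => (w i).re) ⬝ᵥ (fun i => (w i).re) + (fun i => (w i).im) ⬝ᵥ (fun i => (w i).im) := by
  simp only [dotProduct, Pi.star_apply, Complex.re_sum, Complex.mul_re, Complex.star_def,
    Complex.conj_re, Complex.conj_im, ← Finset.sum_add_distrib]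
  refine Finset.sum_congr rfl fun i _ => ?_
  ring

/-- A real quadratic-form lower bound `lo · (x ⬝ᵥ x) ≤ x ⬝ᵥ (A x)` for all real `x` gives the complex
one: `lo · Re ⟨w, w⟩ ≤ Re ⟨w, A w⟩` for all complex `w`. -/
theorem re_star_dotProduct_map_mulVec_ge {ι : Type*} [Fintype ι] (A : Matrix ι ι ℝ) (lo : ℝ)
    (h : ∀ x : ι → ℝ, lo * (x ⬝ᵥ x) ≤ x ⬝ᵥ (A *ᵥ x)) (w : ι → ℂ) :
    lo * (star w ⬝ᵥ w).re ≤ (star w ⬝ᵥ ((A.map ((↑) : ℝ → ℂ)) *ᵥ w)).re := by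
  rw [re_star_dotProduct_map_mulVec, re_star_dotProduct_self, mul_add]
  exact add_le_add (h _) (h _)

/-! ### The variational form of a lower row -/

section Bridge

variable {k : ℕ}

/-- **Lower rows, variational form.** For a symmetric model and a sector `a, b ≤ k`: if
`lo · ⟨ψ, ψ⟩ ≤ Re ⟨ψ, H_F ψ⟩` for every vector `ψ` of the `(a, b)` sector, then `LowerRow F a b lo`
(the sector energy `E₀(H_F; a, b)` is the energy of a unit eigenvector lying in the sector,
`exists_unit_eigen_sectorGroundEnergy`). -/
theorem lowerRow_of_forall_isInSector {F : Model k} (hF : F.IsSymmetric) {a b : ℕ} (ha : a ≤ k)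
    (hb : b ≤ k) {lo : ℚ}
    (h : ∀ ψ : Fock (Orb (Fin k)), IsInSector a b ψ →
      (lo : ℝ) * (star ψ ⬝ᵥ ψ).re ≤ (star ψ ⬝ᵥ (F.hamiltonian *ᵥ ψ)).re) :
    LowerRow F a b lo := by
  refine ⟨ha, hb, ?_⟩
  obtain ⟨ψ, hψ, hψ1, hHψ⟩ := exists_unit_eigen_sectorGroundEnergy (Model.hamiltonian_isHermitian hF)
    (a := a) (b := b) (by simpa using ha) (by simpa using hb)
  have hHψ' : F.hamiltonian *ᵥ ψ = ((F.energy a b : ℝ) : ℂ) • ψ := hHψ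
  have key := h ψ hψ
  rw [hHψ', dotProduct_smul, hψ1, smul_eq_mul, mul_one, Complex.ofReal_re, Complex.one_re,
    mul_one] at key
  exact key

/-- Re-indexing a sum supported on the `(a, b)` sector by an enumeration of the sector. -/
theorem sum_eq_sum_enum_of_support {a b : ℕ} {ι : Type*} [Fintype ι]
    (d : ι → Finset (Orb (Fin k))) (hinj : Function.Injective d)
    (hsurj : ∀ s : Finset (Orb (Fin k)), (upPart s).card = a ∧ (downPart s).card = b → ∃ i, d i = s)
    (f : Finset (Orb (Fin k)) → ℂ)
    (hf : ∀ s, ¬((upPart s).card = a ∧ (downPart s).card = b) → f s = 0) :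
    ∑ s, f s = ∑ i, f (d i) := by
  classical
  rw [← Finset.sum_image (f := f) (s := Finset.univ) (g := d) fun i _ j _ hij => hinj hij]
  symm
  refine Finset.sum_subset (Finset.subset_univ _) fun s _ hs => hf s fun hsec => hs ?_
  obtain ⟨i, rfl⟩ := hsurj s hsec
  exact Finset.mem_image_of_mem d (Finset.mem_univ i)

/-- **THE SECTOR-BLOCK BRIDGE (TYP-17 (b)(ii)).** `F` a symmetric model, `a, b ≤ k`, `d : ι → occupation
sets` an enumeration of the `(a, b)` sector (injective, and every occupation set with `a` up and `b` down
electrons is some `d i` — i.e. `(|d i⟩)_i` is an orthonormal family spanning the sector; indices `i` with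
`d i` OUTSIDE the sector, if any, are harmless: sector vectors vanish there, so the hypothesis is only
used through the sector part of `A`),
`A i j = F.slaterCondon (d i) (d j)` the (real, ℚ-valued) matrix of `H_F` on that family. If
`lo · (w ⬝ᵥ w) ≤ w ⬝ᵥ (A *ᵥ w)` for every real `w` ("`A` bounded below by `lo·I`"), then
`LowerRow F a b lo`, i.e. `lo ≤ E₀(H_F; a, b)`. -/
theorem lowerRow_of_sectorBlock_form {F : Model k} (hF : F.IsSymmetric) {a b : ℕ} (ha : a ≤ k)
    (hb : b ≤ k) {lo : ℚ} {ι : Type*} [Fintype ι] (d : ι → Finset (Orb (Fin k)))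
    (hinj : Function.Injective d)
    (hsurj : ∀ s : Finset (Orb (Fin k)), (upPart s).card = a ∧ (downPart s).card = b → ∃ i, d i = s)
    (hform : ∀ w : ι → ℝ, (lo : ℝ) * (w ⬝ᵥ w) ≤
      w ⬝ᵥ ((Matrix.of fun i j => (F.slaterCondon (d i) (d j) : ℝ)) *ᵥ w)) :
    LowerRow F a b lo := by
  classical
  refine lowerRow_of_forall_isInSector hF ha hb fun ψ hψ => ?_
  -- the norm and the energy of a sector vector, re-indexed by `d`
  set w : ι → ℂ := fun i => ψ (d i) with hw
  have hnorm : star ψ ⬝ᵥ ψ = star w ⬝ᵥ w := by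
    simp only [dotProduct, Pi.star_apply, hw]
    exact sum_eq_sum_enum_of_support d hinj hsurj _ fun s hs => by rw [hψ s hs, mul_zero]
  have hener : star ψ ⬝ᵥ (F.hamiltonian *ᵥ ψ) =
      star w ⬝ᵥ (((Matrix.of fun i j => (F.slaterCondon (d i) (d j) : ℝ)).map ((↑) : ℝ → ℂ)) *ᵥ w) := by
    simp only [dotProduct, mulVec, Pi.star_apply, Matrix.map_apply, Matrix.of_apply, hw]
    rw [sum_eq_sum_enum_of_support d hinj hsurj _ fun s hs => by rw [hψ s hs, star_zero, zero_mul]]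
    refine Finset.sum_congr rfl fun i _ => ?_
    congr 1
    rw [sum_eq_sum_enum_of_support d hinj hsurj _ fun t ht => by rw [hψ t ht, mul_zero]]
    refine Finset.sum_congr rfl fun j _ => ?_
    rw [Model.hamiltonian_apply_eq_slaterCondon, Complex.ofReal_ratCast]
  rw [hnorm, hener]
  exact re_star_dotProduct_map_mulVec_ge _ _ hform w

/-- **The bridge with the bound packaged as positive semidefiniteness** ("the matrix of `H` on the family
bounded below by `E·I`"): `(A − lo·1) ⪰ 0` over `ℝ` for `A i j = F.slaterCondon (d i) (d j)` gives
`LowerRow F a b lo`. -/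
theorem lowerRow_of_sectorBlock_sub_posSemidef {F : Model k} (hF : F.IsSymmetric) {a b : ℕ}
    (ha : a ≤ k) (hb : b ≤ k) {lo : ℚ} {ι : Type*} [Fintype ι] [DecidableEq ι]
    (d : ι → Finset (Orb (Fin k))) (hinj : Function.Injective d)
    (hsurj : ∀ s : Finset (Orb (Fin k)), (upPart s).card = a ∧ (downPart s).card = b → ∃ i, d i = s)
    (hpsd : ((Matrix.of fun i j => (F.slaterCondon (d i) (d j) : ℝ)) -
      (lo : ℝ) • (1 : Matrix ι ι ℝ)).PosSemidef) :
    LowerRow F a b lo := by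
  refine lowerRow_of_sectorBlock_form hF ha hb d hinj hsurj fun w => ?_
  have h0 := hpsd.dotProduct_mulVec_nonneg w
  rw [sub_mulVec, dotProduct_sub, smul_mulVec, one_mulVec, dotProduct_smul, smul_eq_mul,
    star_trivial, sub_nonneg] at h0
  exact h0

/-- **The bridge from BLOCKS** (the D2h-blocked form of a `qc-lower-chol-v0` certificate): if `A` is
block diagonal for a labelling `lab : ι → G` of the enumerated sector and on every block the form is
bounded below by `lo · ‖·‖²`, then `LowerRow F a b lo` (assembly by
`le_dotProduct_mulVec_of_blockDiagonal` of `Rows/CholeskyResidualBound.lean`, then the bridge). -/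
theorem lowerRow_of_sectorBlock_blocks {F : Model k} (hF : F.IsSymmetric) {a b : ℕ} (ha : a ≤ k)
    (hb : b ≤ k) {lo : ℚ} {ι : Type*} [Fintype ι] {G : Type*} [Fintype G] [DecidableEq G]
    (d : ι → Finset (Orb (Fin k))) (hinj : Function.Injective d)
    (hsurj : ∀ s : Finset (Orb (Fin k)), (upPart s).card = a ∧ (downPart s).card = b → ∃ i, d i = s)
    (lab : ι → G)
    (hblock : ∀ i j, lab i ≠ lab j → F.slaterCondon (d i) (d j) = 0)
    (hlo : ∀ g (w : {i // lab i = g} → ℝ), (lo : ℝ) * (w ⬝ᵥ w) ≤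
      w ⬝ᵥ (((Matrix.of fun i j => (F.slaterCondon (d i) (d j) : ℝ)).submatrix Subtype.val
        Subtype.val) *ᵥ w)) :
    LowerRow F a b lo :=
  lowerRow_of_sectorBlock_form hF ha hb d hinj hsurj fun w =>
    le_dotProduct_mulVec_of_blockDiagonal _ lab (lo : ℝ)
      (fun i j hij => by rw [Matrix.of_apply, hblock i j hij, Rat.cast_zero]) hlo w

end Bridge

end Summit.Ventures.CertifiedQuantumChemistry

end
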